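import Summits.HubbardSuperconductivity.HubbardSuperconductivity.Theorems.InfiniteVolumeFirstTightnessExchange

/-!
# Route `InfiniteVolumeFirst`, crux `NoNormalLimitState` (stmt-HubbardSuperconductivity-18533) —
# line `window-gap-transfer`, stub `stub_windowFloorAtom` (window floors at every scale force the atom)

For any family `ψ_L` of torus Fock vectors normalised at even sides and any `a > 0`: if for every
window radius `ε > 0` the window pair weight `Σ_{|q_m| ≤ ε} S_{ψ_L}(m)` is at least `a L²` for all
large even `L` (threshold depending on `ε`), then every pointwise limit `C` of the
translation-averaged `d`-wave pair correlations along a strictly increasing sequence of even sides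
has `liminf_R R⁻⁴ Σ_{x,y ∈ [0,R)²} C(x − y) ≥ a`.

Proof (finite Fourier analysis on `(ℤ/Lℤ)²` + a limit; no Hamiltonian):
* `normSq_charSum_ge` — the one-dimensional kernel LOWER bound
  `|Σ_{v<R} e(kv)|² = Σ_{v,w<R} cos((v−w)θ_k) ≥ R²(1 − R²θ_k²/2)`, `θ_k = 2π·valMinAbs(k)/L`
  (`cos x ≥ 1 − x²/2`, `(v − w)² ≤ R²`);
* `normSq_blockKernel_ge` — the block kernel `F(m) = Σ_{u ∈ [0,R)²} χ_m(u) = Π_i Σ_{v<R} e(m_i v)`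
  obeys `|F(m)|² ≥ R⁴(1 − R²|q_m|²/2)` (`|q_m|² = momentumNormSq L m`; product of the two coordinate
  bounds with both factors in `[0, R²]`);
* `block_plancherel'` — `L² Σ_a ‖B_aψ‖² = Σ_m |F(m)|² ‖Δ_d(m)ψ‖²` for the block pair operators
  `B_a = Σ_{u∈[0,R)²} P_{a+u}` (operator Plancherel `sum_conjTranspose_mul_fourierMode`; re-derived,
  the copy in `WeakCouplingBCSWcbcsSsbToTorusLROFejerClosure.lean` being private);
* `boxMean_ge_window` — with `tightnessExchange_boxSum_eq`:
  `R⁻⁴ Σ_{x,y∈[0,R)²} C_L(x−y) ≥ (1 − R²ε²/2) · L⁻² Σ_{|q_m|≤ε} S_L(m)` (drop the off-window modes,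
  all terms nonnegative);
* the stub: let `j → ∞` at fixed `R ≥ 1`, `ε > 0` (finite sums of pointwise limits), obtaining
  `R⁻⁴ Σ_{x,y} C(x−y) ≥ (1 − R²ε²/2) a`, then `ε → 0`; `le_liminf_of_le` with `|C| ≤ C_d²`.

Kennedy–Lieb–Shastry, PRL 61 (1988) 2582 (Fourier modes of an order operator, Parseval);
Friedli–Velenik (2017) §10.4; Stein–Shakarchi, *Fourier Analysis*, Ch. 2 (Fejér kernel). No
definition, no named fact. Intended landing: `--supports stmt-HubbardSuperconductivity-18533`
(proves the registered stub `stub_windowFloorAtom` by name and signature).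
-/

noncomputable section

set_option linter.dupNamespace false

namespace Summit.HubbardSuperconductivity.HubbardSuperconductivity.Theorems.NoNormalLimitState

open Literature.MathematicalPhysics.QuantumLattice Literature.Probability.LatticeModels Matrix Finset
  Filter
open scoped ComplexConjugate ComplexOrder Topology

/-! ### The one-dimensional kernel lower bound -/

section Kernel

variable {L : ℕ} [NeZero L]

/-- The character value `e(k·v) = exp(i θ_k v)` with the least-absolute-value angle
`θ_k = 2π valMinAbs(k)/L`. [folklore] -/
theorem stdAddChar_mul_natCast_eq_exp (k : ZMod L) (v : ℕ) :
    (ZMod.stdAddChar (k * ((v : ℕ) : ZMod L)) : ℂ) =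
      Complex.exp (((2 * Real.pi * ((k.valMinAbs : ℤ) : ℝ) / (L : ℝ) * (v : ℝ) : ℝ) : ℂ) * Complex.I) := by
  have hk : k * ((v : ℕ) : ZMod L) = (((k.valMinAbs * (v : ℤ) : ℤ)) : ZMod L) := by
    simp [ZMod.coe_valMinAbs]
  rw [hk, ZMod.stdAddChar_coe]
  congr 1
  push_cast
  ring

/-- **One-dimensional kernel lower bound.** For `k ∈ ℤ/Lℤ` and `R`:
`|Σ_{v<R} e(kv)|² ≥ R² (1 − R² θ_k²/2)`, `θ_k = 2π valMinAbs(k)/L`: expand the modulus square as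
`Σ_{v,w} cos((v−w)θ_k)` and use `cos x ≥ 1 − x²/2`, `(v−w)² ≤ R²`.
Stein–Shakarchi, *Fourier Analysis*, Ch. 2 (Fejér kernel). [folklore] -/
theorem normSq_charSum_ge (k : ZMod L) (R : ℕ) :
    (R : ℝ) ^ 2 * (1 - (R : ℝ) ^ 2 *
        ((2 * Real.pi / (L : ℝ)) ^ 2 * ((k.valMinAbs : ℤ) : ℝ) ^ 2) / 2) ≤
      ‖∑ v : Fin R, (ZMod.stdAddChar (k * ((v : ℕ) : ZMod L)) : ℂ)‖ ^ 2 := by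
  set θ : ℝ := 2 * Real.pi * ((k.valMinAbs : ℤ) : ℝ) / (L : ℝ) with hθ
  have hterm : ∀ v : Fin R, (ZMod.stdAddChar (k * ((v : ℕ) : ZMod L)) : ℂ) =
      Complex.exp (((θ * (v : ℕ) : ℝ) : ℂ) * Complex.I) := fun v => by
    rw [stdAddChar_mul_natCast_eq_exp, hθ]
  simp_rw [hterm]
  -- real and imaginary parts
  have hre : (∑ v : Fin R, Complex.exp (((θ * (v : ℕ) : ℝ) : ℂ) * Complex.I)).re =
      ∑ v : Fin R, Real.cos (θ * (v : ℕ)) := by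
    rw [Complex.re_sum]
    exact Finset.sum_congr rfl fun v _ => Complex.exp_ofReal_mul_I_re _
  have him : (∑ v : Fin R, Complex.exp (((θ * (v : ℕ) : ℝ) : ℂ) * Complex.I)).im =
      ∑ v : Fin R, Real.sin (θ * (v : ℕ)) := by
    rw [Complex.im_sum]
    exact Finset.sum_congr rfl fun v _ => Complex.exp_ofReal_mul_I_im _
  rw [Complex.sq_norm, Complex.normSq_apply, hre, him, Finset.sum_mul_sum, Finset.sum_mul_sum,
    ← Finset.sum_add_distrib]
  simp_rw [← Finset.sum_add_distrib]
  -- each term is `cos (θ v - θ w) ≥ 1 - R² θ² / 2`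
  have hvw : ∀ v w : Fin R, 1 - (R : ℝ) ^ 2 * θ ^ 2 / 2 ≤
      Real.cos (θ * (v : ℕ)) * Real.cos (θ * (w : ℕ)) +
        Real.sin (θ * (v : ℕ)) * Real.sin (θ * (w : ℕ)) := by
    intro v w
    rw [← Real.cos_sub]
    have h1 := Real.one_sub_sq_div_two_le_cos (x := θ * (v : ℕ) - θ * (w : ℕ))
    have h2 : (θ * (v : ℕ) - θ * (w : ℕ)) ^ 2 ≤ (R : ℝ) ^ 2 * θ ^ 2 := by
      have hv : ((v : ℕ) : ℝ) < R := by exact_mod_cast v.2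
      have hw : ((w : ℕ) : ℝ) < R := by exact_mod_cast w.2
      have hv0 : (0 : ℝ) ≤ ((v : ℕ) : ℝ) := Nat.cast_nonneg _
      have hw0 : (0 : ℝ) ≤ ((w : ℕ) : ℝ) := Nat.cast_nonneg _
      have hd : (((v : ℕ) : ℝ) - ((w : ℕ) : ℝ)) ^ 2 ≤ (R : ℝ) ^ 2 :=
        sq_le_sq' (by linarith) (by linarith)
      calc (θ * (v : ℕ) - θ * (w : ℕ)) ^ 2 = θ ^ 2 * (((v : ℕ) : ℝ) - ((w : ℕ) : ℝ)) ^ 2 := by ring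
        _ ≤ θ ^ 2 * (R : ℝ) ^ 2 := mul_le_mul_of_nonneg_left hd (sq_nonneg _)
        _ = (R : ℝ) ^ 2 * θ ^ 2 := by ring
    linarith
  calc (R : ℝ) ^ 2 * (1 - (R : ℝ) ^ 2 * ((2 * Real.pi / (L : ℝ)) ^ 2 * ((k.valMinAbs : ℤ) : ℝ) ^ 2) / 2)
      = ∑ _v : Fin R, ∑ _w : Fin R, (1 - (R : ℝ) ^ 2 * θ ^ 2 / 2) := by
        rw [Finset.sum_const, Finset.sum_const, Finset.card_univ, Fintype.card_fin, smul_smul,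
          nsmul_eq_mul, hθ]
        push_cast
        ring
    _ ≤ _ := Finset.sum_le_sum fun v _ => Finset.sum_le_sum fun w _ => hvw v w

/-- **Block kernel as a product** (`Σ_{u∈[0,R)^d} χ_m(u) = Π_i Σ_{v<R} e(m_i v)`). [folklore] -/
theorem blockKernel_eq_prod' {d : ℕ} (m : TorusSite d L) (R : ℕ) :
    ∑ u : Fin d → Fin R, torusChar m (fun i => ((u i : ℕ) : ZMod L)) =
      ∏ i, ∑ v : Fin R, (ZMod.stdAddChar (m i * ((v : ℕ) : ZMod L)) : ℂ) := by
  rw [Fintype.prod_sum]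
  rfl

/-- `|Σ_{v<R} e(kv)| ≤ R`. [folklore] -/
theorem norm_charSum_le (k : ZMod L) (R : ℕ) :
    ‖∑ v : Fin R, (ZMod.stdAddChar (k * ((v : ℕ) : ZMod L)) : ℂ)‖ ≤ R := by
  refine (norm_sum_le _ _).trans ?_
  have h : ∀ v : Fin R, ‖(ZMod.stdAddChar (k * ((v : ℕ) : ZMod L)) : ℂ)‖ = 1 := fun v =>
    AddChar.norm_apply _ _
  simp [h]

/-- An elementary inequality: if `A, B ≥ 0`, `r ≥ 0`, `A ≥ r(1 − a)`, `B ≥ r(1 − b)` with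
`a, b ≥ 0`, then `A·B ≥ r²(1 − a − b)`. [folklore] -/
theorem mul_ge_of_factors {A B r a b : ℝ} (hr : 0 ≤ r) (hA0 : 0 ≤ A) (hB0 : 0 ≤ B)
    (ha : 0 ≤ a) (hb : 0 ≤ b) (hA : r * (1 - a) ≤ A) (hB : r * (1 - b) ≤ B) :
    r ^ 2 * (1 - a - b) ≤ A * B := by
  by_cases h1 : 1 - a ≤ 0
  · have : r ^ 2 * (1 - a - b) ≤ 0 :=
      mul_nonpos_of_nonneg_of_nonpos (sq_nonneg r) (by linarith)
    exact this.trans (mul_nonneg hA0 hB0)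
  · push Not at h1
    -- `A B ≥ r(1-a) B ≥ r(1-a) r(1-b) ≥ r²(1-a-b)`
    have h2 : r * (1 - a) * B ≤ A * B := mul_le_mul_of_nonneg_right hA hB0
    have h3 : r * (1 - a) * (r * (1 - b)) ≤ r * (1 - a) * B :=
      mul_le_mul_of_nonneg_left hB (mul_nonneg hr h1.le)
    have h4 : r ^ 2 * (1 - a - b) ≤ r * (1 - a) * (r * (1 - b)) := by
      have : 0 ≤ r ^ 2 * (a * b) := mul_nonneg (sq_nonneg r) (mul_nonneg ha hb)
      nlinarith
    linarith

/-- **Block kernel lower bound** (`d = 2`): `|F(m)|² ≥ R⁴ (1 − R² |q_m|²/2)` with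
`|q_m|² = momentumNormSq L m` — the window-side companion of the tree's off-window bound
`|F(m)|² |q_m|² ≤ 2π² R²`. Stein–Shakarchi, *Fourier Analysis*, Ch. 2. [folklore] -/
theorem normSq_blockKernel_ge (m : TorusSite 2 L) (R : ℕ) :
    (R : ℝ) ^ 4 * (1 - (R : ℝ) ^ 2 * momentumNormSq L m / 2) ≤
      ‖∑ u : Fin 2 → Fin R, torusChar m (fun i => ((u i : ℕ) : ZMod L))‖ ^ 2 := by
  rw [blockKernel_eq_prod', norm_prod, Fin.prod_univ_two, mul_pow, momentumNormSq_apply,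
    Fin.sum_univ_two]
  set G0 := ‖∑ v : Fin R, (ZMod.stdAddChar (m 0 * ((v : ℕ) : ZMod L)) : ℂ)‖ with hG0
  set G1 := ‖∑ v : Fin R, (ZMod.stdAddChar (m 1 * ((v : ℕ) : ZMod L)) : ℂ)‖ with hG1
  set c : ℝ := (2 * Real.pi / (L : ℝ)) ^ 2 with hc
  set a : ℝ := (R : ℝ) ^ 2 * (c * (((m 0).valMinAbs : ℤ) : ℝ) ^ 2) / 2 with ha
  set b : ℝ := (R : ℝ) ^ 2 * (c * (((m 1).valMinAbs : ℤ) : ℝ) ^ 2) / 2 with hb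
  have hA : (R : ℝ) ^ 2 * (1 - a) ≤ G0 ^ 2 := by rw [ha, hc]; exact normSq_charSum_ge (m 0) R
  have hB : (R : ℝ) ^ 2 * (1 - b) ≤ G1 ^ 2 := by rw [hb, hc]; exact normSq_charSum_ge (m 1) R
  have ha0 : 0 ≤ a := by rw [ha, hc]; positivity
  have hb0 : 0 ≤ b := by rw [hb, hc]; positivity
  have key := mul_ge_of_factors (r := (R : ℝ) ^ 2) (by positivity) (sq_nonneg G0) (sq_nonneg G1)
    ha0 hb0 hA hB
  calc (R : ℝ) ^ 4 * (1 - (R : ℝ) ^ 2 * (c * ((((m 0).valMinAbs : ℤ) : ℝ) ^ 2 +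
        (((m 1).valMinAbs : ℤ) : ℝ) ^ 2)) / 2)
      = ((R : ℝ) ^ 2) ^ 2 * (1 - a - b) := by rw [ha, hb]; ring
    _ ≤ G0 ^ 2 * G1 ^ 2 := key

end Kernel

/-! ### Block Plancherel (re-derived; the tree's copy is private) -/

section Plancherel

variable {d L : ℕ} [NeZero L] {n : Type*} [Fintype n]

/-- `z · conj z = |z|²` with `star` spelling and a real cast. [folklore] -/
theorem mul_star_self_eq_ofReal' (z : ℂ) : z * star z = ((‖z‖ ^ 2 : ℝ) : ℂ) := by
  rw [Complex.star_def, Complex.mul_conj']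
  push_cast
  rfl

omit [Fintype n] in
/-- **Fourier mode of the block family**: for any family `P_x` of matrices on the torus and
`B_a = Σ_{u ∈ [0,R)^d} P_{a+u}`, `Σ_a conj χ_m(a) B_a = F(m) • Σ_y conj χ_m(y) P_y` with the block
kernel `F(m) = Σ_u χ_m(u)`. Friedli–Velenik (2017) §10.4. [folklore] -/
theorem fourierMode_block' (P : TorusSite d L → Matrix n n ℂ) (R : ℕ) (m : TorusSite d L) :
    ∑ a : TorusSite d L, conj (torusChar m a) •
        (∑ u : Fin d → Fin R, P (a + fun i => ((u i : ℕ) : ZMod L))) =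
      (∑ u : Fin d → Fin R, torusChar m (fun i => ((u i : ℕ) : ZMod L))) •
        ∑ y : TorusSite d L, conj (torusChar m y) • P y := by
  rw [Finset.sum_smul]
  simp_rw [Finset.smul_sum]
  rw [Finset.sum_comm]
  refine Finset.sum_congr rfl fun u _ => ?_
  refine Fintype.sum_equiv (Equiv.addRight (fun i => ((u i : ℕ) : ZMod L))) _ _ fun a => ?_
  simp only [Equiv.coe_addRight]
  rw [smul_smul, torusChar_add_right, map_mul, mul_left_comm, torusChar_mul_conj, mul_one]

/-- **Block Plancherel, vector form**: `L^d · Σ_a ‖B_a ψ‖² = Σ_m |F(m)|² ‖Δ(m) ψ‖²` for the blocks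
`B_a = Σ_{u ∈ [0,R)^d} P_{a+u}` and modes `Δ(m) = Σ_y conj χ_m(y) P_y`.
Kennedy–Lieb–Shastry, PRL 61 (1988) 2582 (Parseval sum rule). [folklore] -/
theorem block_plancherel' (P : TorusSite d L → Matrix n n ℂ) (R : ℕ) (ψ : n → ℂ) :
    (L : ℝ) ^ d * ∑ a : TorusSite d L,
        (star ((∑ u : Fin d → Fin R, P (a + fun i => ((u i : ℕ) : ZMod L))) *ᵥ ψ) ⬝ᵥ
          ((∑ u : Fin d → Fin R, P (a + fun i => ((u i : ℕ) : ZMod L))) *ᵥ ψ)).re =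
      ∑ m : TorusSite d L,
        ‖∑ u : Fin d → Fin R, torusChar m (fun i => ((u i : ℕ) : ZMod L))‖ ^ 2 *
          (star ((∑ y, conj (torusChar m y) • P y) *ᵥ ψ) ⬝ᵥ
            ((∑ y, conj (torusChar m y) • P y) *ᵥ ψ)).re := by
  have h := sum_conjTranspose_mul_fourierMode
    (fun a => ∑ u : Fin d → Fin R, P (a + fun i => ((u i : ℕ) : ZMod L)))
  simp only [fourierMode_block', conjTranspose_smul, Matrix.smul_mul, Matrix.mul_smul, smul_smul,
    mul_star_self_eq_ofReal'] at h
  have h' := congrArg (fun T => (star ψ ⬝ᵥ (T *ᵥ ψ)).re) h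
  simp only [sum_mulVec, dotProduct_sum, smul_mulVec, dotProduct_smul, smul_eq_mul,
    Complex.re_sum, Complex.re_ofReal_mul] at h'
  have hc : ((L : ℂ) ^ d) = (((L : ℝ) ^ d : ℝ) : ℂ) := by push_cast; rfl
  rw [hc, Complex.re_ofReal_mul, Complex.re_sum] at h'
  simp_rw [star_mulVec_dotProduct_mulVec]
  exact h'.symm

end Plancherel

/-! ### The lower Fejér bound at a fixed side -/

/-- **Box means dominate the window** (finite `L = n + 1`, any family, any `R > 0`, any `ε`):
`(1 − R²ε²/2) · L⁻² Σ_{|q_m|² ≤ ε²} S_L(m) ≤ R⁻⁴ Σ_{x,y ∈ [0,R)²} C_L(x − y)`,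
`C_L(z) = L⁻² Σ_w G_L(z + w, w)` the translation-averaged pair correlation and
`S_L = pairStructureFactor`: the box double sum is block pair coherence
(`tightnessExchange_boxSum_eq`), block Plancherel turns it into `L⁻² Σ_m |F(m)|² S_L(m)`, the
off-window modes are dropped (nonnegative) and on the window `|F(m)|² ≥ R⁴(1 − R²ε²/2)`
(`normSq_blockKernel_ge`). Kennedy–Lieb–Shastry, PRL 61 (1988) 2582. [folklore] -/
theorem boxMean_ge_window (ψ : ∀ L, Fock (Orb (FermionTorus 2 L))) (n R : ℕ) (hR : 0 < R)
    (ε : ℝ) :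
    (1 - (R : ℝ) ^ 2 * ε ^ 2 / 2) *
        ((∑ m : TorusSite 2 (n + 1), if momentumNormSq (n + 1) m ≤ ε ^ 2 then
            pairStructureFactor dWaveFormFactor (n + 1) (ψ (n + 1)) m else 0) /
          ((n + 1 : ℕ) : ℝ) ^ 2) ≤
      (∑ x ∈ halfOpenBox 2 R, ∑ y ∈ halfOpenBox 2 R,
          (∑ w ∈ halfOpenBox 2 (n + 1),
            torusPullback (pairFieldCorr dWaveFormFactor ψ) (n + 1) (x - y + w) w) /
              ((n + 1 : ℕ) : ℝ) ^ 2) / (R : ℝ) ^ 4 := by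
  classical
  rw [tightnessExchange_boxSum_eq]
  have hRpos : (0 : ℝ) < R := Nat.cast_pos.2 hR
  have hLpos : (0 : ℝ) < ((n + 1 : ℕ) : ℝ) := by positivity
  have hL2 : ((n + 1 : ℕ) : ℝ) ^ 2 ≠ 0 := pow_ne_zero _ hLpos.ne'
  set S : TorusSite 2 (n + 1) → ℝ := pairStructureFactor dWaveFormFactor (n + 1) (ψ (n + 1)) with hS
  obtain ⟨F, hF⟩ : ∃ F : TorusSite 2 (n + 1) → ℂ,
      ∀ m, F m = ∑ u : Fin 2 → Fin R, torusChar m (fun i => ((u i : ℕ) : ZMod (n + 1))) :=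
    ⟨fun m => _, fun m => rfl⟩
  -- block Plancherel: `Σ_a ‖B_a ψ‖² = Σ_m |F(m)|² S(m)`
  have hblock : (∑ a : TorusSite 2 (n + 1), star ((∑ u : Fin 2 → Fin R,
      localPair dWaveFormFactor (n + 1) (a + fun i => ((u i : ℕ) : ZMod (n + 1)))) *ᵥ ψ (n + 1)) ⬝ᵥ
      ((∑ u : Fin 2 → Fin R,
      localPair dWaveFormFactor (n + 1) (a + fun i => ((u i : ℕ) : ZMod (n + 1)))) *ᵥ ψ (n + 1))).re =
      ∑ m, ‖F m‖ ^ 2 * S m := by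
    have h := block_plancherel' (localPair dWaveFormFactor (n + 1)) R (ψ (n + 1))
    simp only [← pairFieldAt_eq_sum_torusChar, ← hF] at h
    have hSm : ∀ m, (star (pairFieldAt dWaveFormFactor (n + 1) m *ᵥ ψ (n + 1)) ⬝ᵥ
        (pairFieldAt dWaveFormFactor (n + 1) m *ᵥ ψ (n + 1))).re = ((n + 1 : ℕ) : ℝ) ^ 2 * S m :=
      fun m => by rw [hS, pairStructureFactor_apply, mul_div_cancel₀ _ hL2]
    simp only [hSm] at h
    rw [Complex.re_sum]
    refine mul_left_cancel₀ hL2 ?_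
    rw [h, Finset.mul_sum]
    exact Finset.sum_congr rfl fun m _ => by ring
  rw [hblock]
  -- termwise lower bound on the window, zero elsewhere
  have hSnn : ∀ m, 0 ≤ S m := fun m => pairStructureFactor_nonneg _ _ _ _
  have hpt : ∀ m ∈ (Finset.univ : Finset (TorusSite 2 (n + 1))),
      (R : ℝ) ^ 4 * (1 - (R : ℝ) ^ 2 * ε ^ 2 / 2) *
          (if momentumNormSq (n + 1) m ≤ ε ^ 2 then S m else 0) ≤ ‖F m‖ ^ 2 * S m := by
    intro m _
    split_ifs with hm
    · have hk := normSq_blockKernel_ge m R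
      rw [← hF] at hk
      have hmono : (R : ℝ) ^ 4 * (1 - (R : ℝ) ^ 2 * ε ^ 2 / 2) ≤
          (R : ℝ) ^ 4 * (1 - (R : ℝ) ^ 2 * momentumNormSq (n + 1) m / 2) := by
        have : (R : ℝ) ^ 2 * momentumNormSq (n + 1) m ≤ (R : ℝ) ^ 2 * ε ^ 2 :=
          mul_le_mul_of_nonneg_left hm (sq_nonneg _)
        nlinarith [sq_nonneg ((R : ℝ) ^ 2)]
      exact mul_le_mul_of_nonneg_right (hmono.trans hk) (hSnn m)
    · rw [mul_zero]
      exact mul_nonneg (sq_nonneg _) (hSnn m)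
  have hsum := Finset.sum_le_sum hpt
  rw [← Finset.mul_sum] at hsum
  -- divide by `L² R⁴`
  rw [div_div, le_div_iff₀ (by positivity)]
  calc (1 - (R : ℝ) ^ 2 * ε ^ 2 / 2) *
        ((∑ m : TorusSite 2 (n + 1), if momentumNormSq (n + 1) m ≤ ε ^ 2 then S m else 0) /
          ((n + 1 : ℕ) : ℝ) ^ 2) * (((n + 1 : ℕ) : ℝ) ^ 2 * (R : ℝ) ^ 4)
      = (R : ℝ) ^ 4 * (1 - (R : ℝ) ^ 2 * ε ^ 2 / 2) *
          ∑ m : TorusSite 2 (n + 1), (if momentumNormSq (n + 1) m ≤ ε ^ 2 then S m else 0) := by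
        field_simp
    _ ≤ ∑ m, ‖F m‖ ^ 2 * S m := hsum

/-! ### The stub -/

/-- **`stub_windowFloorAtom` of line `window-gap-transfer`** (crux `NoNormalLimitState`,
stmt-HubbardSuperconductivity-18533): window pair-weight floors at every scale force the atom of
every pointwise limit. For `R ≥ 1` and `ε ∈ (0, 1/R]`, eventually in `j` the box mean at side
`L_j` is `≥ (1 − R²ε²/2)·a` (`boxMean_ge_window` and the floor); pass to the limit `j → ∞` (finite
sums), then `ε → 0⁺`; finally `le_liminf_of_le` with the bound `|C| ≤ C_d²`.
Kennedy–Lieb–Shastry, PRL 61 (1988) 2582; Friedli–Velenik (2017) §10.4. [folklore] -/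
theorem stub_windowFloorAtom :
    ∀ (ψ : ∀ L, Fock (Orb (FermionTorus 2 L))) (a : ℝ), 0 < a →
      (∀ L, Even L → star (ψ L) ⬝ᵥ ψ L = 1) →
      (∀ ε : ℝ, 0 < ε → ∃ L₀ : ℕ, ∀ (L : ℕ) [NeZero L], Even L → L₀ ≤ L →
        a * (L : ℝ) ^ 2 ≤ ∑ m : TorusSite 2 L,
          if momentumNormSq L m ≤ ε ^ 2 then pairStructureFactor dWaveFormFactor L (ψ L) m else 0) →
      ∀ (Ls : ℕ → ℕ) (C : Site 2 → ℝ), StrictMono Ls → (∀ j, Even (Ls j)) →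
        (∀ x : Site 2, Tendsto (fun j : ℕ => (∑ y ∈ halfOpenBox 2 (Ls j),
          torusPullback (pairFieldCorr dWaveFormFactor ψ) (Ls j) (x + y) y) / ((Ls j : ℕ) : ℝ) ^ 2)
          atTop (𝓝 (C x))) →
        a ≤ liminf (fun R : ℕ => (∑ x ∈ halfOpenBox 2 R, ∑ y ∈ halfOpenBox 2 R, C (x - y)) /
          ((R : ℕ) : ℝ) ^ 4) atTop := by
  intro ψ a ha hnorm hfloor Ls C hLs hev hconv
  -- the constant `C_d²`
  obtain ⟨B, hB⟩ : ∃ B : ℝ, B = (∑ e ∈ insert (0 : Site 2) unitSteps,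
      ‖((dWaveFormFactor e / Real.sqrt 2 : ℝ) : ℂ)‖ * 2) ^ 2 := ⟨_, rfl⟩
  have hB0 : 0 ≤ B := by rw [hB]; positivity
  -- the translation-averaged pair correlations
  obtain ⟨Cavg, hCavg⟩ : ∃ Cavg : ℕ → Site 2 → ℝ, ∀ L x, Cavg L x =
      (∑ y ∈ halfOpenBox 2 L, torusPullback (pairFieldCorr dWaveFormFactor ψ) L (x + y) y) /
        ((L : ℕ) : ℝ) ^ 2 := ⟨_, fun _ _ => rfl⟩
  have hCB : ∀ j x, |Cavg (Ls j) x| ≤ B := fun j x => by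
    rw [hCavg, hB]; exact tightnessExchange_abs_corrAvg_le ψ _ (hnorm _ (hev j)) x
  have hconv' : ∀ x : Site 2, Tendsto (fun j => Cavg (Ls j) x) atTop (𝓝 (C x)) := fun x => by
    simpa only [hCavg] using hconv x
  have hCbd : ∀ x, |C x| ≤ B := fun x =>
    le_of_tendsto ((continuous_abs.tendsto _).comp (hconv' x)) (Eventually.of_forall (hCB · x))
  -- the box means of the limit
  obtain ⟨b, hb⟩ : ∃ b : ℕ → ℝ, ∀ R, b R = (∑ x ∈ halfOpenBox 2 R, ∑ y ∈ halfOpenBox 2 R,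
      C (x - y)) / ((R : ℕ) : ℝ) ^ 4 := ⟨_, fun _ => rfl⟩
  have hfun : (fun R : ℕ => (∑ x ∈ halfOpenBox 2 R, ∑ y ∈ halfOpenBox 2 R, C (x - y)) /
      ((R : ℕ) : ℝ) ^ 4) = b := funext fun R => (hb R).symm
  rw [hfun]
  -- `b` is bounded above by `B`
  have hb_up : ∀ R, b R ≤ B := by
    intro R
    rw [hb]
    rcases Nat.eq_zero_or_pos R with rfl | hRpos
    · simpa using hB0
    · rw [div_le_iff₀ (by positivity)]
      calc ∑ x ∈ halfOpenBox 2 R, ∑ y ∈ halfOpenBox 2 R, C (x - y)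
          ≤ ∑ x ∈ halfOpenBox 2 R, ∑ y ∈ halfOpenBox 2 R, B :=
            Finset.sum_le_sum fun x _ => Finset.sum_le_sum fun y _ => (abs_le.1 (hCbd _)).2
        _ = B * ((R : ℕ) : ℝ) ^ 4 := by
            rw [Finset.sum_const, Finset.sum_const, card_halfOpenBox, smul_smul, nsmul_eq_mul]
            push_cast
            ring
  -- Step 1: at every block scale `R ≥ 1` and window `ε > 0`, `b R ≥ (1 − R²ε²/2)·a`
  have hstep : ∀ R : ℕ, 0 < R → ∀ ε : ℝ, 0 < ε → (R : ℝ) ^ 2 * ε ^ 2 ≤ 2 →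
      (1 - (R : ℝ) ^ 2 * ε ^ 2 / 2) * a ≤ b R := by
    intro R hRpos ε hε hRε
    obtain ⟨L₀, hL₀⟩ := hfloor ε hε
    have hbj : Tendsto (fun j => (∑ x ∈ halfOpenBox 2 R, ∑ y ∈ halfOpenBox 2 R,
        Cavg (Ls j) (x - y)) / ((R : ℕ) : ℝ) ^ 4) atTop (𝓝 (b R)) := by
      rw [hb]
      exact (tendsto_finsetSum _ fun x _ => tendsto_finsetSum _ fun y _ =>
        hconv' (x - y)).div_const _
    refine ge_of_tendsto hbj ?_
    have hevj : ∀ᶠ j in atTop, max L₀ 1 ≤ Ls j := hLs.tendsto_atTop.eventually_ge_atTop _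
    filter_upwards [hevj] with j hj
    obtain ⟨n, hn⟩ : ∃ n, Ls j = n + 1 := ⟨Ls j - 1, by omega⟩
    have hevn : Even (n + 1) := hn ▸ hev j
    have hfl := hL₀ (n + 1) hevn (by omega)
    have hfl' : a ≤ (∑ m : TorusSite 2 (n + 1), if momentumNormSq (n + 1) m ≤ ε ^ 2 then
        pairStructureFactor dWaveFormFactor (n + 1) (ψ (n + 1)) m else 0) / ((n + 1 : ℕ) : ℝ) ^ 2 := by
      rw [le_div_iff₀ (by positivity)]; exact hfl
    have hfac : 0 ≤ 1 - (R : ℝ) ^ 2 * ε ^ 2 / 2 := by linarith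
    have hbox := boxMean_ge_window ψ n R hRpos ε
    rw [hn]
    simp only [hCavg]
    exact (mul_le_mul_of_nonneg_left hfl' hfac).trans hbox
  -- Step 2: let `ε → 0⁺`: `b R ≥ a` for every `R ≥ 1`
  have hbR : ∀ R : ℕ, 0 < R → a ≤ b R := by
    intro R hRpos
    have hR1 : (1 : ℝ) ≤ R := by exact_mod_cast hRpos
    refine le_of_forall_pos_le_add fun η hη => ?_
    -- choose `ε ≤ 1/R` with `(R² a/2) ε ≤ η`
    set K : ℝ := (R : ℝ) ^ 2 * a / 2 with hK
    have hK0 : 0 ≤ K := by rw [hK]; positivity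
    set ε : ℝ := min (1 / (R : ℝ)) (η / (K + 1)) with hεdef
    have hε : 0 < ε := lt_min (by positivity) (by positivity)
    have hεR : ε ≤ 1 / (R : ℝ) := min_le_left _ _
    have hεη : ε ≤ η / (K + 1) := min_le_right _ _
    have hε1 : ε ≤ 1 := hεR.trans (by rw [div_le_one (by positivity)]; exact hR1)
    have hRε1 : (R : ℝ) * ε ≤ 1 := by
      rw [le_div_iff₀ (by positivity)] at hεR; linarith [mul_comm (R : ℝ) ε]
    have hRε : (R : ℝ) ^ 2 * ε ^ 2 ≤ 2 := by
      have : ((R : ℝ) * ε) ^ 2 ≤ 1 := by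
        rw [sq_le_one_iff₀ (by positivity)]; exact hRε1
      nlinarith
    have h := hstep R hRpos ε hε hRε
    -- `(R² ε²/2) a = K ε² ≤ K ε ≤ η`
    have hKε : K * ε ^ 2 ≤ η := by
      have h1 : ε ^ 2 ≤ ε := by nlinarith
      have h2 : K * ε ≤ η := by
        rw [le_div_iff₀ (by positivity)] at hεη
        nlinarith
      nlinarith
    have : (1 - (R : ℝ) ^ 2 * ε ^ 2 / 2) * a = a - K * ε ^ 2 := by rw [hK]; ring
    linarith
  -- Step 3: the liminf
  have hevR : ∀ᶠ R : ℕ in atTop, a ≤ b R := by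
    filter_upwards [eventually_gt_atTop 0] with R hR using hbR R hR
  exact le_liminf_of_le (isBoundedUnder_of ⟨B, fun R => hb_up R⟩).isCoboundedUnder_ge hevR


end Summit.HubbardSuperconductivity.HubbardSuperconductivity.Theorems.NoNormalLimitState

end
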